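import Literature.NumberTheory.Transcendental.CurvePeriodsEllipticLiftLinearityProofs
import Literature.NumberTheory.Transcendental.CurvePeriodsBakerProofs
import Summits.KontsevichZagierPeriods.KontsevichZagierPeriods.Theorems.KzOnePeriodsG0Derivation

/-!
# KontsevichZagierPeriods — kz1p class E1 derivations, part 1: ℤ-linear relations of lifted symbols at every base point

Cell pub-kz1p (KZ 1-periods), seat b2b-kz1p-2 (IMPLEMENTER), gen 13; helper of the rung-1 item
`stmt-KontsevichZagierPeriods-4990`, companion of `KzOnePeriodsG0Deriv*.lean` (class G0) and of seat 1's
`KzOnePeriodsE1CMDeriv.lean`.  Pure mathematics over the tree's formal period space `CurvePeriods`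
(Huber–Wüstholz 2022, §13.1 (A)–(B), Thm. 13.3 (2)); no named facts, no `sorry`, no new definitions.

The kz1p decision procedure (class E1, forms of the first kind) answers a query
`Σᵢ αᵢ u(Xᵢ) + β₁ ω₁ + β₂ ω₂ = 0 ?` on `E : y² = x³ + ax + b` over `ℚ` by exhibiting integer relations
`Σ_l n_l m_l = 0` among the elliptic logarithms `m_l ∈ {u(Xᵢ), ω₁, ω₂}` and an exact decomposition of the query
over `ℚ̄` into these relations.  This file supplies the SYMBOL-LEVEL half of the connected derivation:

* `span_zsum_theta0` — for algebraic logarithms `m_l` (`Ell.AlgLog`) and integers `n_l` with `Σ n_l m_l = 0`,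
  at EVERY algebraic base point `t₀` and for ALL `C¹` lifts `D_l : t₀ ↝ t₀ + m_l` avoiding `Λ`,
  `Σ_l n_l · (E_L, θ₀, φ∘D_l)` lies in the `ℚ̄`-span of the elementary relations (R1)–(R5)
  (`θ₀` = the tree's polynomial representative of `dx/y`).  The tree proves this at a GENERIC base point
  (`Ell.zexpand`, `Ell.zzero`); the passage to every base point is translation by an algebraic point
  (`Ell.LiftData.span_translate_theta0`, (R4)+(R5)) from a base point generic for finitely many congruence
  and half-congruence conditions (`exists_generic_algPt₂`, a parity refinement of `Ell.exists_generic_algPt`).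
* `span_zsum_omega` — the same for kz1p's input form `ω = dx/(2y) = ½θ₀` ((R1b)), whose lifted symbol
  `(E_L, ½θ₀, φ∘D)`, `D : t₀ ↝ t₀ + m`, has period exactly `m` (`evalCombination_sym_omega`).
* `span_of_coef_eq` — assembly of the input combination from the relations by exact linear algebra over `ℚ̄`,
  and soundness `evalCombination = 0` (`G0Derivation.evalCombination_eq_zero_of_span`, Thm. 13.3 (2)).

Dictionary (kz1p ↔ tree): `E : y² = x³ + ax + b` is `Ell.curve L = weierCurve (A L) (B L)` for a period pair
`L` with `g₂ = −4a`, `g₃ = −4b` (`A L = −g₂/4`, `B L = −g₃/4`), `(x, y) = φ(z) = (℘(z), ℘′(z)/2)`; the symbol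
`u(X) = ∫_O^X ω` at the algebraic base point `T₀ = φ(t₀)` is `(E_L, ½θ₀, φ∘D_X)`, `D_X : t₀ ↝ t₀ + u_X`
(re-basing by translation, H–W §13.1 (B): `∫_{T₀}^{T₀+X} ω = ∫_O^X ω`), and `[ω₁]` is `(E_L, ½θ₀, φ∘D)`
for a lift `D : t₀ ↝ t₀ + Ω₁` of a closed loop.  Part 2 (`KzOnePeriodsE1DerivRealLogs.lean`) supplies the
NUMBER-LEVEL half (real principal logarithms, lattice integers decided by sign rules).

References: [HuberWustholz2022] A. Huber, G. Wüstholz, *Transcendence and linear relations of 1-periods*,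
Cambridge Tracts 227 (2022), §13.1 (pp. 119–121), Thm. 13.3 (p. 121), §18.1 (pp. 160–161);
[KontsevichZagier2001] M. Kontsevich, D. Zagier, *Periods* (2001), §1.1.
-/

noncomputable section

open MvPolynomial Set Complex
open Literature.NumberTheory.Transcendental Literature.NumberTheory.Transcendental.CurvePeriods
open Literature.NumberTheory.Transcendental.CurvePeriods.Ell
open scoped PeriodPair

namespace Summit.KontsevichZagierPeriods.KzOnePeriods.E1LiftDerivation

local notation3 "InSpanRel " c:arg => ∃ (k : ℕ) (ρ : Fin k → (PeriodSymbol →₀ ℂ))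
  (a : Fin k → ℂ), (∀ l, IsElementaryRelation (ρ l)) ∧ (∀ l, IsAlgebraic ℚ (a l)) ∧
    c = ∑ l, a l • ρ l

variable {L : PeriodPair} (h₂ : IsAlgebraic ℚ L.g₂) (h₃ : IsAlgebraic ℚ L.g₃)

/-- The `θ₀`-symbol `(E_L, θ₀, φ∘D)` of a lift `D`. -/
local notation3 "S₀[" D "]" => LiftData.sym h₂ h₃ D (theta0 L) (hasAlgCoeffs_theta0 L h₂ h₃)

/-! ### Half-congruences: generic algebraic base points with halving conditions -/

/-- If `2t − c ∈ Λ` then `t` is congruent to one of the four points `c/2 + (ε₁ω₁ + ε₂ω₂)/2`,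
`εᵢ ∈ {0, 1}`. [folklore] -/
theorem half_translate_mem_of_two_mul_sub_mem {t c : ℂ} (h : 2 * t - c ∈ L.lattice) :
    t - c / 2 ∈ L.lattice ∨ t - (c / 2 + L.ω₁ / 2) ∈ L.lattice ∨
      t - (c / 2 + L.ω₂ / 2) ∈ L.lattice ∨ t - (c / 2 + (L.ω₁ + L.ω₂) / 2) ∈ L.lattice := by
  obtain ⟨m, n, hmn⟩ := PeriodPair.mem_lattice.1 h
  have key : ∀ a b : ℤ, (a : ℂ) * L.ω₁ + (b : ℂ) * L.ω₂ ∈ L.lattice := fun a b =>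
    PeriodPair.mem_lattice.2 ⟨a, b, rfl⟩
  obtain ⟨m', hm'⟩ := Int.even_or_odd' m
  obtain ⟨n', hn'⟩ := Int.even_or_odd' n
  rcases hm' with rfl | rfl <;> rcases hn' with rfl | rfl
  · refine Or.inl ?_
    have e : t - c / 2 = (m' : ℂ) * L.ω₁ + (n' : ℂ) * L.ω₂ := by
      push_cast at hmn; linear_combination (-1 / 2 : ℂ) * hmn
    rw [e]; exact key m' n'
  · refine Or.inr (Or.inr (Or.inl ?_))
    have e : t - (c / 2 + L.ω₂ / 2) = (m' : ℂ) * L.ω₁ + (n' : ℂ) * L.ω₂ := by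
      push_cast at hmn; linear_combination (-1 / 2 : ℂ) * hmn
    rw [e]; exact key m' n'
  · refine Or.inr (Or.inl ?_)
    have e : t - (c / 2 + L.ω₁ / 2) = (m' : ℂ) * L.ω₁ + (n' : ℂ) * L.ω₂ := by
      push_cast at hmn; linear_combination (-1 / 2 : ℂ) * hmn
    rw [e]; exact key m' n'
  · refine Or.inr (Or.inr (Or.inr ?_))
    have e : t - (c / 2 + (L.ω₁ + L.ω₂) / 2) = (m' : ℂ) * L.ω₁ + (n' : ℂ) * L.ω₂ := by
      push_cast at hmn; linear_combination (-1 / 2 : ℂ) * hmn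
    rw [e]; exact key m' n'

include h₂ h₃ in
/-- **Generic algebraic base points with halving conditions.** For finite `B, C ⊂ ℂ` there is an
algebraic point `φ(t)` with `t ∉ b + Λ` (`b ∈ B`) and `2t ∉ c + Λ` (`c ∈ C`)
(`Ell.exists_generic_algPt` applied to `B` and the `4|C|` points `c/2 + (ε₁ω₁ + ε₂ω₂)/2`). [folklore] -/
theorem exists_generic_algPt₂ (B C : Finset ℂ) :
    ∃ t : ℂ, IsAlgPt L t ∧ (∀ b ∈ B, t - b ∉ L.lattice) ∧ ∀ c ∈ C, 2 * t - c ∉ L.lattice := by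
  classical
  obtain ⟨t, ht, hgen⟩ := exists_generic_algPt L h₂ h₃
    (B ∪ C.image (fun c => c / 2) ∪ C.image (fun c => c / 2 + L.ω₁ / 2) ∪
      C.image (fun c => c / 2 + L.ω₂ / 2) ∪ C.image (fun c => c / 2 + (L.ω₁ + L.ω₂) / 2))
  refine ⟨t, ht, fun b hb => hgen b (Finset.mem_union_left _ (Finset.mem_union_left _
    (Finset.mem_union_left _ (Finset.mem_union_left _ hb)))), fun c hc hmem => ?_⟩
  rcases half_translate_mem_of_two_mul_sub_mem hmem with h | h | h | h
  · exact hgen _ (Finset.mem_union_left _ (Finset.mem_union_left _ (Finset.mem_union_left _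
      (Finset.mem_union_right _ (Finset.mem_image_of_mem _ hc))))) h
  · exact hgen _ (Finset.mem_union_left _ (Finset.mem_union_left _
      (Finset.mem_union_right _ (Finset.mem_image_of_mem _ hc)))) h
  · exact hgen _ (Finset.mem_union_left _ (Finset.mem_union_right _ (Finset.mem_image_of_mem _ hc))) h
  · exact hgen _ (Finset.mem_union_right _ (Finset.mem_image_of_mem _ hc)) h

/-! ### ℤ-linear relations of lifted `θ₀`-symbols at every algebraic base point -/

include h₂ h₃ in
/-- **Symbol-level ℤ-linear relation at every base point.**  Let `m_l` be algebraic logarithms and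
`n_l ∈ ℤ` with `Σ_l n_l m_l = 0`.  Then for EVERY algebraic base point `t₀` and ALL lifts
`D_l : t₀ ↝ t₀ + m_l`, `Σ_l n_l (E_L, θ₀, φ∘D_l) ∈ ⟨(R1)–(R5)⟩_ℚ̄`.  Proof: at a base point `t₁` generic for
the finite set of `Ell.zexpand` and for the conditions `t₁ ∉ t₀ + Λ`, `2t₁ ∉ t₀ + Λ`, `2t₁ ∉ t₀ − m_l + Λ`
the relation holds (`zexpand` + `zzero`); translation by the algebraic point `φ(t₀ − t₁)` carries each
`(E_L, θ₀, φ∘D′_l)`, `D′_l : t₁ ↝ t₁ + m_l`, to `(E_L, θ₀, φ∘D_l)` (`span_translate_theta0`; the genericity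
makes the translation map regular at the four end points).
[cite: HuberWustholz2022, §13.1 (B) (p. 120), §18.1 (pp. 160–161)] -/
theorem span_zsum_theta0 {r : ℕ} (m : Fin r → ℂ) (hm : ∀ l, AlgLog L (m l)) (n : Fin r → ℤ)
    (hsum : ∑ l, (n l : ℂ) * m l = 0) {t₀ : ℂ} (ht₀ : IsAlgPt L t₀)
    (D : ∀ l, LiftData L t₀ (t₀ + m l)) :
    InSpanRel (∑ l, (n l : ℂ) • S₀[D l]) := by
  classical
  have ht : ∀ l, t₀ + m l ∉ L.lattice := fun l => (D l).alg_stop.1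
  obtain ⟨B, hB⟩ := zexpand h₂ h₃ r m hm n
  obtain ⟨t₁, ht₁, hgen, hgen2⟩ := exists_generic_algPt₂ h₂ h₃ (insert t₀ B)
    (insert t₀ (Finset.univ.image fun l => t₀ - m l))
  obtain ⟨halg, halgs, hrel⟩ := hB t₁ ht₁ (fun b hb => hgen b (Finset.mem_insert_of_mem hb))
  set v := t₀ - t₁ with hv
  have hv0 : v ∉ L.lattice := by
    intro h
    exact hgen t₀ (Finset.mem_insert_self t₀ B) (by simpa [hv] using neg_mem h)
  have hvalg : IsAlgPt L v := (ht₀.algLog.sub L h₂ ht₁.algLog).isAlgPt hv0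
  have D₁ : ∀ l, LiftData L t₁ (t₁ + m l) := fun l => (LiftData.nonempty ht₁ (halg l)).some
  obtain ⟨Dsum⟩ := LiftData.nonempty ht₁ halgs
  have hz : t₁ + ∑ l, (n l : ℂ) * m l = t₁ := by rw [hsum, add_zero]
  have h1 : InSpanRel (S₀[Dsum] - ∑ l, (n l : ℂ) • S₀[D₁ l]) := (hrel Dsum D₁).1
  have h2 : InSpanRel (S₀[Dsum]) := zzero h₂ h₃ hz Dsum _ _
  have h3 : InSpanRel (∑ l, (n l : ℂ) • S₀[D₁ l]) := by
    have h := CurvePeriods.span_sub h2 h1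
    rwa [sub_sub_cancel] at h
  have h4 : ∀ l, InSpanRel (S₀[D l] - S₀[D₁ l]) := by
    intro l
    have e0 : t₁ + v = t₀ := by rw [hv]; ring
    have e1 : t₁ + m l + v = t₀ + m l := by rw [hv]; ring
    have ha : ℘[L] t₁ ≠ ℘[L] v := by
      rw [weierstrassP_ne_iff L ht₁.1 hv0]
      refine ⟨by rw [e0]; exact ht₀.1, ?_⟩
      have : 2 * t₁ - t₀ ∉ L.lattice := hgen2 t₀ (Finset.mem_insert_self _ _)
      convert this using 1; rw [hv]; ring
    have hb : ℘[L] (t₁ + m l) ≠ ℘[L] v := by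
      rw [weierstrassP_ne_iff L (halg l).1 hv0]
      refine ⟨by rw [e1]; exact ht l, ?_⟩
      have : 2 * t₁ - (t₀ - m l) ∉ L.lattice := hgen2 (t₀ - m l)
        (Finset.mem_insert_of_mem (Finset.mem_image_of_mem _ (Finset.mem_univ l)))
      convert this using 1; rw [hv]; ring
    have key := LiftData.span_translate_theta0 h₂ h₃ hvalg (D₁ l) ((D l).cast e0.symm e1.symm) ha hb
    rwa [LiftData.sym_cast] at key
  have h5 : InSpanRel (∑ l, (n l : ℂ) • (S₀[D l] - S₀[D₁ l])) :=
    CurvePeriods.span_finsetSum _ _ fun l _ => CurvePeriods.span_smul (isAlgebraic_int (n l)) (h4 l)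
  have e : ∑ l, (n l : ℂ) • S₀[D l] =
      ∑ l, (n l : ℂ) • (S₀[D l] - S₀[D₁ l]) + ∑ l, (n l : ℂ) • S₀[D₁ l] := by
    rw [← Finset.sum_add_distrib]
    exact Finset.sum_congr rfl fun l _ => by rw [smul_sub, sub_add_cancel]
  rw [e]
  exact CurvePeriods.span_add h5 h3

/-! ### kz1p's input form `ω = dx/(2y) = ½θ₀` -/

include h₂ h₃ in
/-- `½θ₀` has algebraic coefficients. [folklore] -/
theorem hasAlgCoeffs_half_theta0 : ∀ k, HasAlgCoeffs (((1 / 2 : ℂ) • theta0 L) k) := fun k => by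
  have h : IsAlgebraic ℚ (1 / 2 : ℂ) := by rw [one_div]; exact (isAlgebraic_nat 2).inv
  have e : ((1 / 2 : ℂ) • theta0 L) k = C (1 / 2 : ℂ) * theta0 L k := by
    rw [Pi.smul_apply, smul_eq_C_mul]
  rw [e]
  exact (hasAlgCoeffs_C h).mul (hasAlgCoeffs_theta0 L h₂ h₃ k)

/-- The kz1p symbol `(E_L, ½θ₀, φ∘D)` of a lift `D` (form `ω = dx/(2y)`). -/
local notation3 (prettyPrint := false) "Sω[" D "]" =>
  LiftData.sym h₂ h₃ D ((1 / 2 : ℂ) • theta0 L) (hasAlgCoeffs_half_theta0 h₂ h₃)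

include h₂ h₃ in
/-- **(R1b)**: `(E_L, ½θ₀, γ) − ½ (E_L, θ₀, γ) ∈ ⟨(R1)–(R5)⟩_ℚ̄`. [cite: HuberWustholz2022, §13.1 (A) (p. 120)] -/
theorem span_sym_omega_sub {a b : ℂ} (D : LiftData L a b) :
    InSpanRel (Sω[D] - (1 / 2 : ℂ) • S₀[D]) := by
  have h : IsAlgebraic ℚ (1 / 2 : ℂ) := by rw [one_div]; exact (isAlgebraic_nat 2).inv
  refine ⟨1, fun _ => Sω[D] - (1 / 2 : ℂ) • S₀[D], fun _ => 1, fun _ => ?_,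
    fun _ => isAlgebraic_one, by simp⟩
  exact IsElementaryRelation.smul (curve L) (smooth L h₂ h₃) D.path (1 / 2 : ℂ) h (theta0 L)
    ((1 / 2 : ℂ) • theta0 L) (hasAlgCoeffs_theta0 L h₂ h₃) (hasAlgCoeffs_half_theta0 h₂ h₃) rfl

include h₂ h₃ in
/-- **The period of the kz1p symbol**: `∫_{φ∘D} dx/(2y) = b − a` for a lift `D : a ↝ b`
(`θ₀ = dx/y` has period `2(b − a)` along `φ∘D`). [cite: HuberWustholz2022, §18.1 (p. 160)] -/
theorem evalCombination_sym_omega {a b : ℂ} (D : LiftData L a b) :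
    evalCombination Sω[D] = b - a := by
  have h0 := G0Derivation.evalCombination_eq_zero_of_span (span_sym_omega_sub h₂ h₃ D)
  rw [evalCombination_sub, evalCombination_smul, LiftData.evalCombination_sym_theta0, sub_eq_zero] at h0
  rw [h0]; ring

/-- The period of the single symbol underlying `Sω[D]` is `b − a`. [cite: HuberWustholz2022, §18.1 (p. 160)] -/
theorem period_sym_omega {a b : ℂ} (D : LiftData L a b) :
    PeriodSymbol.period ⟨curve L, smooth L h₂ h₃, (1 / 2 : ℂ) • theta0 L,
      hasAlgCoeffs_half_theta0 h₂ h₃, D.path⟩ = b - a := by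
  have h := evalCombination_sym_omega h₂ h₃ D
  rwa [LiftData.sym, evalCombination_single, one_mul] at h

include h₂ h₃ in
/-- **Symbol-level ℤ-linear relation for kz1p's form `ω = ½θ₀`** at every algebraic base point and
for all lifts: `Σ n_l m_l = 0` ⟹ `Σ_l n_l (E_L, ½θ₀, φ∘D_l) ∈ ⟨(R1)–(R5)⟩_ℚ̄`.
[cite: HuberWustholz2022, §13.1 (A)–(B) (p. 120), §18.1 (pp. 160–161)] -/
theorem span_zsum_omega {r : ℕ} (m : Fin r → ℂ) (hm : ∀ l, AlgLog L (m l)) (n : Fin r → ℤ)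
    (hsum : ∑ l, (n l : ℂ) * m l = 0) {t₀ : ℂ} (ht₀ : IsAlgPt L t₀)
    (D : ∀ l, LiftData L t₀ (t₀ + m l)) :
    InSpanRel (∑ l, (n l : ℂ) • Sω[D l]) := by
  have h : IsAlgebraic ℚ (1 / 2 : ℂ) := by rw [one_div]; exact (isAlgebraic_nat 2).inv
  have h1 : InSpanRel (∑ l, (n l : ℂ) • (Sω[D l] - (1 / 2 : ℂ) • S₀[D l])) :=
    CurvePeriods.span_finsetSum _ _ fun l _ => CurvePeriods.span_smul (isAlgebraic_int (n l))
      (span_sym_omega_sub h₂ h₃ (D l))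
  have h2 : InSpanRel ((1 / 2 : ℂ) • ∑ l, (n l : ℂ) • S₀[D l]) :=
    CurvePeriods.span_smul h (span_zsum_theta0 h₂ h₃ m hm n hsum ht₀ D)
  have e : ∑ l, (n l : ℂ) • Sω[D l] =
      ∑ l, (n l : ℂ) • (Sω[D l] - (1 / 2 : ℂ) • S₀[D l]) + (1 / 2 : ℂ) • ∑ l, (n l : ℂ) • S₀[D l] := by
    rw [Finset.smul_sum, ← Finset.sum_add_distrib]
    exact Finset.sum_congr rfl fun l _ => by rw [smul_sub, smul_comm, sub_add_cancel]
  rw [e]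
  exact CurvePeriods.span_add h1 h2

/-! ### Assembly of the input combination by exact linear algebra over `ℚ̄` -/

/-- **Assembly.** If `Σⱼ K_tj Sⱼ ∈ ⟨(R1)–(R5)⟩_ℚ̄` for each `t` and `αⱼ = Σ_t λ_t K_tj` with `λ_t ∈ ℚ̄`,
then `Σⱼ αⱼ Sⱼ ∈ ⟨(R1)–(R5)⟩_ℚ̄`. [cite: HuberWustholz2022, §13.1 (p. 120)] -/
theorem span_of_coef_eq {n T : ℕ} (S : Fin n → (PeriodSymbol →₀ ℂ)) (α : Fin n → ℂ)
    (K : Fin T → Fin n → ℂ) (hrel : ∀ t, InSpanRel (∑ j, K t j • S j))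
    (lam : Fin T → ℂ) (hlam : ∀ t, IsAlgebraic ℚ (lam t))
    (hcoef : ∀ j, α j = ∑ t, lam t * K t j) : InSpanRel (∑ j, α j • S j) := by
  have h : InSpanRel (∑ t, lam t • ∑ j, K t j • S j) :=
    CurvePeriods.span_finsetSum _ _ fun t _ => CurvePeriods.span_smul (hlam t) (hrel t)
  have e : ∑ j, α j • S j = ∑ t, lam t • ∑ j, K t j • S j := by
    simp_rw [Finset.smul_sum, smul_smul]
    rw [Finset.sum_comm]
    exact Finset.sum_congr rfl fun j _ => by rw [← Finset.sum_smul, ← hcoef j]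
  rw [e]; exact h

/-- **Integer relations are algebraic-coefficient relations**: the cast of an integer vector.
[folklore] -/
theorem isAlgebraic_intCast (n : ℤ) : IsAlgebraic ℚ ((n : ℤ) : ℂ) := isAlgebraic_int n

end Summit.KontsevichZagierPeriods.KzOnePeriods.E1LiftDerivation

end
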